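import Literature.AlgebraicGeometry.AbelianSchemes.PELTupleSpreadStageOfStageDuals        -- ★ p848288: stage currency, `IsBaseChangeVia` kit
import Literature.AlgebraicGeometry.AbelianSchemes.LDeltaRigidifiedFibrewiseAmple            -- ★ B10 (α)
import Literature.AlgebraicGeometry.Limits.LocalizationRelativeRankOneSpread                -- ★ p848351 (β)
import Literature.AlgebraicGeometry.AbelianSchemes.RankOneRigidifyAlongUnitSection           -- ★ p848375 (η)
import Literature.AlgebraicGeometry.AbelianSchemes.RankOneAmpleClassSpreadStage              -- ★ p848139 (γ)
import Literature.AlgebraicGeometry.Limits.LocalizationGenericGeometricPointFactor          -- ★ p848178 (ζ)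
import Literature.AlgebraicGeometry.AbelianSchemes.PolarizationLevelBaseQuotientDescent      -- ★ `IsBaseChangeVia.exists_fibreIso`
import Literature.AlgebraicGeometry.AbelianSchemes.MumfordQuotientConstruction               -- ★ `pullback_unitSection_detClass_baseChange_eq_one`
import Literature.AlgebraicGeometry.AbelianSchemes.AbelianSchemeKOfLBaseChange                -- ★ `IsBaseChangeVia.pullback_unitSection_detClass_pullback_eq_one`
import Literature.AlgebraicGeometry.AbelianVarieties.SymmetricDivisorClassPullback           -- ★ `symmetric_pullback_toSchemeHom`
import HarnessLib

/-!
# From a generic polarization to a RIGIDIFIED rank-one bundle of AMPLE CLASS at every geometric point (SYMMETRIC at the characteristic-`0` ones)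
# on a STAGE restriction `𝒜ₜ ×_{P⊗D(t)} (P ⊗ D(s))` ([MumfordFogartyKirwan1994] Ch. 6 §2; [EGAIV3] 8.5.2 ∕ 8.10.5 spreading; [GortzWedhorn2023] Thm. 24.46)

Layer `Literature/AlgebraicGeometry/AbelianSchemes`, namespace `Literature.AlgebraicGeometry.AbelianSchemes.AbelianSchemeOver`.  THEOREMS ONLY
(no definition, no named fact, no instance, no notation, no `sorry`); universe `Scheme.{0}` (that of ★ «AmpleLocusOpen» ∕ ★ `CechPic` kit).  Cell
`hodgecm-mathlib` (D-0151), P6 «MOD programme», L4 DUALS road, **«DUALS-AT-STAGE» FILE 1 = steps 0–5 of the memo of record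
`MEMO-DUALS-AT-STAGE-plan.v1` (LA4-p05 (g0)); LA4-plan (g0) DEAL #9 → LA4-p04 (g0); FILE 2 (steps 6–9, LA4-p05 (g2) DEAL #12) consumes the HEAD of §3
and the transport of §1b** towards the `hdual` binder of ★ `exists_stage_pelTuple_of_generic_of_stageDuals`.  HC_CM is proved only modulo the printed
citations (2 remaining named inputs hLiu418 24832, h413 24833) until rung 0 closes; this file is generic and changes no count.

SETTING (★ `PELTupleSpreadStageOfStageDuals`): `A` a domain integral over `ℤ` with fraction field `K` of characteristic `0`, `P → Spec A` qcqs flat with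
locally Noetherian stages `P ⊗ D(s)` (`D(s) = Spec A[1∕s]`, `s ∈ A ∖ 0`), `A₁` an abelian scheme over the generic base `P ⊗ Spec K` with a dual pair
`D₁` and a polarization `pol₁ : λ`, `𝒜ₜ` an abelian scheme over the stage `P ⊗ D(t)` of which `A₁` is the base change along the cone leg `P ◁ π_t`
(`hbc : IsBaseChangeVia`).

* §1 pointwise transport of «ample (symmetric) Cartier divisor of the class of `L`» on geometric fibres along a base-change relation
  `X′.IsBaseChangeVia Y p π` with `[N′] = π^*[N]`, in both directions (★ `IsBaseChangeVia.exists_fibreIso`: `X′_s ≅ Y_{s ≫ p}` over `π`; ampleness along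
  an isomorphism, symmetry by ★ `symmetric_pullback_toSchemeHom`, classes by `Ȟ¹` functoriality).
* §1b **`IsBaseChangeVia.rankOne_rigidified_ample_pullback`** — the whole triple «`ε^*[L] = 1` ∕ ample class at EVERY geometric point ∕ symmetric ample
  class at every characteristic-`0` geometric point» passes from `(𝒜, L)` to `(𝒜′, G^*L)` along ANY base-change relation `𝒜′.IsBaseChangeVia 𝒜 g G`
  (unit clause ★ `IsBaseChangeVia.pullback_unitSection_detClass_pullback_eq_one` + §1) — the flexible last-mile currency of FILE 2.
* §2 **`Polarization.exists_isAmple_symmetric_pullback_fst_detClass_LDelta_eq_cechClass`** — the fibrewise witness of ★ B10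
  (`Polarization.exists_ample`: `λ_s = φ_Θ`, `Θ` ample, class `[L^Δ(λ)|_{A_s}] = [Θ + (−1)^*Θ]`, ★ `detClass_restrict_LDelta_eq_cechClass_add_pullback_neg`)
  is SYMMETRIC: `Θ + (−1)^*Θ` is ample and `(−1)^*(Θ + (−1)^*Θ) ∼ Θ + (−1)^*Θ` (`(−1)² = 1`, ★ `CartierDivisor.SameDivisor` calculus).
* §3 **`exists_stage_stage_rankOne_rigidified_ample`** (iterated currency) and the HEAD **`exists_stage_rankOne_rigidified_ample`**: for some
  `ρ : s₂ ⟶ t` there is a rank-one `L` on `𝒜ₜ|_{s₂} := 𝒜ₜ ×_{P⊗D(t)} (P ⊗ D(s₂))` with `ε^*[L] = 1`, of the class of an ample divisor at EVERY geometric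
  point of `P ⊗ D(s₂)`, and of the class of a SYMMETRIC ample divisor at every characteristic-`0` geometric point — the binders `hε`∕`hΘ` of ★
  `exists_nat_forall_chart_pow_eq_one_of_memKOfL` and `hwit` of ★ `exists_opens_finite_image_compl_forall_affineOpen_isProjective_of_cechClass` VERBATIM.
  Chain: (α) the Mumford bundle `L₁ = Gr_λ^*𝒫` on `A₁` (★ `hasRank_pullback_graph_P`, §2 at every geometric point), moved to the literal base change
  `𝒜ₜ ×_{P⊗D(t)} (P ⊗ Spec K)` (★ `IsBaseChangeVia.exists_iso_comp_eq`); (β) ★ `exists_stage_hasRank_of_generic` spreads it to a rank-one `M₁` on a stage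
  restriction `𝒜ₜ|_{s₁}`; (η) ★ `exists_rankOne_rigidified_sameFibreClass` rigidifies along the unit section without changing the fibre classes; (γ) ★
  `exists_stage_forall_isAmple_detClass_eq_cechClass` ∕ `exists_isAmple_symmetric_detClass_eq_cechClass_stage_of_generic` give the ample class at every
  geometric point of a finer stage `s₂` and the symmetric one at those factoring through the generic base, which by (ζ) ★
  `exists_eq_comp_whiskerLeft_leg_of_charZero_of_isIntegral_int` are ALL characteristic-`0` geometric points; finally §1b re-bases the iterated
  restriction `(𝒜ₜ|_{s₁})|_{s₂}` onto `𝒜ₜ|_{s₂}` (★ `IsBaseChangeVia.trans`, ★ `whiskerLeft_map_left_comp_whiskerLeft_map_left`).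

## References
* [MumfordFogartyKirwan1994] D. Mumford, J. Fogarty, F. Kirwan, *Geometric Invariant Theory*, 3rd ed. (1994), Ch. 6 §2 Def. 6.2–6.4, Prop. 6.10 (pp. 120–121).
* [MumfordAV1970] D. Mumford, *Abelian Varieties* (1970), §6 Application 1 (p. 60), §8 (pp. 74–75), §13 (p. 123), §23 (p. 231).
* [EGAIV3] A. Grothendieck, J. Dieudonné, *EGA IV₃* (1966), Thm. 8.5.2, Thm. 8.10.5; [StacksProject] Tags 01ZM, 01ZR, 0B8W.
* [GortzWedhorn2023] U. Görtz, T. Wedhorn, *Algebraic Geometry II* (2023), Thm. 24.46 (p. 397); [GortzWedhorn2020] *Algebraic Geometry I*, §(4.7), Prop. 4.16, §(10.13).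
-/

set_option autoImplicit false

noncomputable section

set_option backward.isDefEq.respectTransparency false

open CategoryTheory CategoryTheory.Limits AlgebraicGeometry MonoidalCategory CartesianMonoidalCategory
open scoped MonObj
open Literature.AlgebraicGeometry.Limits Literature.AlgebraicGeometry.Limits.LocApprox
open Literature.AlgebraicGeometry.Motives Literature.AlgebraicGeometry.Modules Literature.AlgebraicGeometry.Morphisms
open Literature.AlgebraicGeometry.AbelianVarieties

namespace Literature.AlgebraicGeometry.Modules

/-- `(𝟙 X)^* = id` on `Ȟ¹(X, 𝒪_X^×)` (★ `UnitCocycle.equiv_of_eq`; the same private lemma as in ★ `RankOneRigidifyAlongUnitSection`). [folklore] -/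
private theorem CechPic.pullback_id'' {X : Scheme.{0}} (a : CechPic X) : CechPic.pullback (𝟙 X) a = a := by
  obtain ⟨c, rfl⟩ := CechPic.mk_surjective a
  rw [CechPic.pullback_mk]
  refine CechPic.sound (UnitCocycle.equiv_of_eq (UnitCocycle.pullback (𝟙 X) c) c c.U c.mem (fun _ => le_rfl) (fun _ => le_rfl) ?_)
  intro x y V hx hy
  change c.g x y V _ _ = (𝟙 X : X ⟶ X).appLE (c.U x ⊓ c.U y) V _ (c.g x y _ inf_le_left inf_le_right)
  rw [Scheme.Hom.appLE, Scheme.Hom.id_app, Category.id_comp]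
  exact (c.map_g x y inf_le_left inf_le_right _).symm

end Literature.AlgebraicGeometry.Modules

namespace Literature.AlgebraicGeometry.AbelianSchemes

namespace AbelianSchemeOver

/-! ## §1 Pointwise transport of «symmetric ample class» along a base-change relation -/

/-- **Pointwise transport, forward**: along a base-change relation `X′.IsBaseChangeVia Y p π` with `[N′] = π^*[N]`, an ample SYMMETRIC Cartier divisor
of class `[N′|]` on the geometric fibre `X′_s` yields one of class `[N|]` on `Y_{s ≫ p}` (pull back along the inverse of ★ `IsBaseChangeVia.exists_fibreIso`).
[cite: MumfordAV1970, §6 Application 1 (p. 60) and §8 (iv) (p. 75)] [cite: GortzWedhorn2020, Section (4.7) (pp. 107–108)] -/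
theorem exists_isAmple_symmetric_cechClass_fibre_of_isBaseChangeVia {S Q : Scheme.{0}} {p : S ⟶ Q}
    {X' : AbelianSchemeOver S} {Y : AbelianSchemeOver Q} {π : X'.X.left ⟶ Y.X.left} (h : X'.IsBaseChangeVia Y p π)
    {N : Y.left.Modules} (hN : HasRank N 1) {N' : X'.left.Modules} (hN' : HasRank N' 1)
    (hNN' : detClass (HasRank.isFiniteLocallyFree' hN') = CechPic.pullback π (detClass (HasRank.isFiniteLocallyFree' hN)))
    {Ω : Type} [Field Ω] [IsAlgClosed Ω] (s : Spec (.of Ω) ⟶ S) (w : Spec (.of Ω) ⟶ Q) (hw : s ≫ p = w)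
    (Θ : CartierDivisor (X'.fibre s).toAbelianVariety.X.left) (hamp : Θ.IsAmple)
    (hsym : (Θ.pullback (AbelianVariety.Hom.toSchemeHom (-𝟙 (X'.fibre s).toAbelianVariety))).LinEquiv Θ)
    (hc : CechPic.pullback (X := (X'.fibre s).toAbelianVariety.X.left) (pullback.fst X'.X.hom s)
      (detClass (HasRank.isFiniteLocallyFree' hN')) = Θ.cechClass) :
    ∃ Θ' : CartierDivisor (Y.fibre w).toAbelianVariety.X.left, Θ'.IsAmple ∧
      (Θ'.pullback (AbelianVariety.Hom.toSchemeHom (-𝟙 (Y.fibre w).toAbelianVariety))).LinEquiv Θ' ∧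
      CechPic.pullback (X := (Y.fibre w).toAbelianVariety.X.left) (pullback.fst Y.X.hom w)
        (detClass (HasRank.isFiniteLocallyFree' hN)) = Θ'.cechClass := by
  subst hw
  obtain ⟨e, he⟩ := h.exists_fibreIso s
  haveI : IsIso (AbelianVariety.Hom.toSchemeHom e.inv) :=
    ⟨AbelianVariety.Hom.toSchemeHom e.hom, by
      change AbelianVariety.Hom.toSchemeHom (e.inv ≫ e.hom) = _; rw [e.inv_hom_id]; rfl, by
      change AbelianVariety.Hom.toSchemeHom (e.hom ≫ e.inv) = _; rw [e.hom_inv_id]; rfl⟩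
  haveI := AbelianVariety.isDominant_toSchemeHom_iso_hom e.symm
  refine ⟨Θ.pullback (AbelianVariety.Hom.toSchemeHom e.inv), hamp.pullback _, ?_, ?_⟩
  · rw [← AbelianVarieties.symmetric_iff_pullback_neg_id_linEquiv] at hsym ⊢
    exact AbelianVarieties.symmetric_pullback_toSchemeHom e.inv hsym
  · have hinv : AbelianVariety.Hom.toSchemeHom e.inv ≫ pullback.fst X'.X.hom s ≫ π = pullback.fst Y.X.hom (s ≫ p) := by
      rw [← he, ← Category.assoc]
      change AbelianVariety.Hom.toSchemeHom (e.inv ≫ e.hom) ≫ _ = _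
      rw [e.inv_hom_id]
      exact Category.id_comp _
    rw [CartierDivisor.cechClass_pullback, ← hc, hNN', ← CechPic.pullback_comp, ← CechPic.pullback_comp, Category.assoc, hinv]

/-- **Pointwise transport, backward**: along `X′.IsBaseChangeVia Y p π` with `[N′] = π^*[N]`, an ample Cartier divisor of class `[N|]` on the geometric fibre
`Y_{s ≫ p}` yields one of class `[N′|]` on `X′_s` (pull back along ★ `IsBaseChangeVia.exists_fibreIso`; ampleness along an isomorphism).
[cite: MumfordAV1970, §6 Application 1 (p. 60)] [cite: GortzWedhorn2020, Section (4.7) (pp. 107–108)] -/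
theorem exists_isAmple_cechClass_fibre_of_isBaseChangeVia_rev {S Q : Scheme.{0}} {p : S ⟶ Q}
    {X' : AbelianSchemeOver S} {Y : AbelianSchemeOver Q} {π : X'.X.left ⟶ Y.X.left} (h : X'.IsBaseChangeVia Y p π)
    {N : Y.left.Modules} (hN : HasRank N 1) {N' : X'.left.Modules} (hN' : HasRank N' 1)
    (hNN' : detClass (HasRank.isFiniteLocallyFree' hN') = CechPic.pullback π (detClass (HasRank.isFiniteLocallyFree' hN)))
    {Ω : Type} [Field Ω] [IsAlgClosed Ω] (s : Spec (.of Ω) ⟶ S) (w : Spec (.of Ω) ⟶ Q) (hw : s ≫ p = w)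
    (Θ : CartierDivisor (Y.fibre w).toAbelianVariety.X.left) (hamp : Θ.IsAmple)
    (hc : CechPic.pullback (X := (Y.fibre w).toAbelianVariety.X.left) (pullback.fst Y.X.hom w)
      (detClass (HasRank.isFiniteLocallyFree' hN)) = Θ.cechClass) :
    ∃ Θ' : CartierDivisor (X'.fibre s).toAbelianVariety.X.left, Θ'.IsAmple ∧
      CechPic.pullback (X := (X'.fibre s).toAbelianVariety.X.left) (pullback.fst X'.X.hom s)
        (detClass (HasRank.isFiniteLocallyFree' hN')) = Θ'.cechClass := by
  subst hw
  obtain ⟨e, he⟩ := h.exists_fibreIso s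
  haveI : IsIso (AbelianVariety.Hom.toSchemeHom e.hom) :=
    ⟨AbelianVariety.Hom.toSchemeHom e.inv, by
      change AbelianVariety.Hom.toSchemeHom (e.hom ≫ e.inv) = _; rw [e.hom_inv_id]; rfl, by
      change AbelianVariety.Hom.toSchemeHom (e.inv ≫ e.hom) = _; rw [e.inv_hom_id]; rfl⟩
  haveI := AbelianVariety.isDominant_toSchemeHom_iso_hom e
  refine ⟨Θ.pullback (AbelianVariety.Hom.toSchemeHom e.hom), hamp.pullback _, ?_⟩
  rw [CartierDivisor.cechClass_pullback, ← hc, ← CechPic.pullback_comp, he, CechPic.pullback_comp, hNN']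

/-- **Pointwise transport, backward, symmetric**: as ★ `exists_isAmple_cechClass_fibre_of_isBaseChangeVia_rev`, keeping `(−1)^*Θ ∼ Θ`
(★ `symmetric_pullback_toSchemeHom` along the fibre isomorphism, a homomorphism).
[cite: MumfordAV1970, §6 Application 1 (p. 60) and §8 (iv) (p. 75)] [cite: GortzWedhorn2020, Section (4.7) (pp. 107–108)] -/
theorem exists_isAmple_symmetric_cechClass_fibre_of_isBaseChangeVia_rev {S Q : Scheme.{0}} {p : S ⟶ Q}
    {X' : AbelianSchemeOver S} {Y : AbelianSchemeOver Q} {π : X'.X.left ⟶ Y.X.left} (h : X'.IsBaseChangeVia Y p π)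
    {N : Y.left.Modules} (hN : HasRank N 1) {N' : X'.left.Modules} (hN' : HasRank N' 1)
    (hNN' : detClass (HasRank.isFiniteLocallyFree' hN') = CechPic.pullback π (detClass (HasRank.isFiniteLocallyFree' hN)))
    {Ω : Type} [Field Ω] [IsAlgClosed Ω] (s : Spec (.of Ω) ⟶ S) (w : Spec (.of Ω) ⟶ Q) (hw : s ≫ p = w)
    (Θ : CartierDivisor (Y.fibre w).toAbelianVariety.X.left) (hamp : Θ.IsAmple)
    (hsym : (Θ.pullback (AbelianVariety.Hom.toSchemeHom (-𝟙 (Y.fibre w).toAbelianVariety))).LinEquiv Θ)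
    (hc : CechPic.pullback (X := (Y.fibre w).toAbelianVariety.X.left) (pullback.fst Y.X.hom w)
      (detClass (HasRank.isFiniteLocallyFree' hN)) = Θ.cechClass) :
    ∃ Θ' : CartierDivisor (X'.fibre s).toAbelianVariety.X.left, Θ'.IsAmple ∧
      (Θ'.pullback (AbelianVariety.Hom.toSchemeHom (-𝟙 (X'.fibre s).toAbelianVariety))).LinEquiv Θ' ∧
      CechPic.pullback (X := (X'.fibre s).toAbelianVariety.X.left) (pullback.fst X'.X.hom s)
        (detClass (HasRank.isFiniteLocallyFree' hN')) = Θ'.cechClass := by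
  subst hw
  obtain ⟨e, he⟩ := h.exists_fibreIso s
  haveI : IsIso (AbelianVariety.Hom.toSchemeHom e.hom) :=
    ⟨AbelianVariety.Hom.toSchemeHom e.inv, by
      change AbelianVariety.Hom.toSchemeHom (e.hom ≫ e.inv) = _; rw [e.hom_inv_id]; rfl, by
      change AbelianVariety.Hom.toSchemeHom (e.inv ≫ e.hom) = _; rw [e.inv_hom_id]; rfl⟩
  haveI := AbelianVariety.isDominant_toSchemeHom_iso_hom e
  refine ⟨Θ.pullback (AbelianVariety.Hom.toSchemeHom e.hom), hamp.pullback _, ?_, ?_⟩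
  · rw [← AbelianVarieties.symmetric_iff_pullback_neg_id_linEquiv] at hsym ⊢
    exact AbelianVarieties.symmetric_pullback_toSchemeHom e.hom hsym
  · rw [CartierDivisor.cechClass_pullback, ← hc, ← CechPic.pullback_comp, he, CechPic.pullback_comp, hNN']

/-! ## §1b Transport of the whole triple «rigidified ∕ ample class everywhere ∕ symmetric ample class in char `0`» along a base-change relation -/

/-- **The triple «rigidified ∕ ample class at every geometric point ∕ symmetric ample class at every characteristic-`0` geometric point» is stable under
base change** in the flexible form: for `𝒜′.IsBaseChangeVia 𝒜 g G` and `L` of rank one on `A` with `ε^*[L] = 1` (`hε`), ample class everywhere (`hΘ`) and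
symmetric ample class in characteristic `0` (`hwit`), the bundle `G^*L` on `A′` has the same three properties over `S′` (a geometric point `s` of `S′` is
read at `s ≫ g`). [cite: MumfordFogartyKirwan1994, Ch. 6 §2 Definition 6.3 and Prop. 6.10 (pp. 120–121)] [cite: GortzWedhorn2020, Section (4.7) (pp. 107–108)] -/
theorem IsBaseChangeVia.rankOne_rigidified_ample_pullback {S S' : Scheme.{0}} {𝒜 : AbelianSchemeOver S} {𝒜' : AbelianSchemeOver S'}
    {g : S' ⟶ S} {G : 𝒜'.X.left ⟶ 𝒜.X.left} (h : 𝒜'.IsBaseChangeVia 𝒜 g G) {L : 𝒜.left.Modules} (hL : HasRank L 1)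
    (hε : CechPic.pullback 𝒜.unitSection (detClass (HasRank.isFiniteLocallyFree' hL)) = 1)
    (hΘ : ∀ ⦃Ω : Type⦄ [Field Ω] [IsAlgClosed Ω] (s : Spec (.of Ω) ⟶ S),
      ∃ Θ : CartierDivisor (𝒜.fibre s).toAbelianVariety.X.left, Θ.IsAmple ∧
        CechPic.pullback (X := (𝒜.fibre s).toAbelianVariety.X.left) (pullback.fst 𝒜.X.hom s)
          (detClass (HasRank.isFiniteLocallyFree' hL)) = Θ.cechClass)
    (hwit : ∀ ⦃Ω : Type⦄ [Field Ω] [IsAlgClosed Ω] [CharZero Ω] (xb : Spec (.of Ω) ⟶ S),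
      ∃ Θ : CartierDivisor (𝒜.fibre xb).toAbelianVariety.X.left, Θ.IsAmple ∧
        (Θ.pullback (AbelianVariety.Hom.toSchemeHom (-𝟙 (𝒜.fibre xb).toAbelianVariety))).LinEquiv Θ ∧
        CechPic.pullback (X := (𝒜.fibre xb).toAbelianVariety.X.left) (pullback.fst 𝒜.X.hom xb)
          (detClass (HasRank.isFiniteLocallyFree' hL)) = Θ.cechClass) :
    CechPic.pullback 𝒜'.unitSection (detClass (HasRank.isFiniteLocallyFree' (hasRank_pullback G hL))) = 1 ∧
    (∀ ⦃Ω : Type⦄ [Field Ω] [IsAlgClosed Ω] (s : Spec (.of Ω) ⟶ S'),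
      ∃ Θ : CartierDivisor (𝒜'.fibre s).toAbelianVariety.X.left, Θ.IsAmple ∧
        CechPic.pullback (X := (𝒜'.fibre s).toAbelianVariety.X.left) (pullback.fst 𝒜'.X.hom s)
          (detClass (HasRank.isFiniteLocallyFree' (hasRank_pullback G hL))) = Θ.cechClass) ∧
    (∀ ⦃Ω : Type⦄ [Field Ω] [IsAlgClosed Ω] [CharZero Ω] (xb : Spec (.of Ω) ⟶ S'),
      ∃ Θ : CartierDivisor (𝒜'.fibre xb).toAbelianVariety.X.left, Θ.IsAmple ∧
        (Θ.pullback (AbelianVariety.Hom.toSchemeHom (-𝟙 (𝒜'.fibre xb).toAbelianVariety))).LinEquiv Θ ∧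
        CechPic.pullback (X := (𝒜'.fibre xb).toAbelianVariety.X.left) (pullback.fst 𝒜'.X.hom xb)
          (detClass (HasRank.isFiniteLocallyFree' (hasRank_pullback G hL))) = Θ.cechClass) := by
  have hc : detClass (HasRank.isFiniteLocallyFree' (hasRank_pullback G hL)) =
      CechPic.pullback G (detClass (HasRank.isFiniteLocallyFree' hL)) :=
    detClass_pullback (f := G) (HasRank.isFiniteLocallyFree' hL)
  refine ⟨h.pullback_unitSection_detClass_pullback_eq_one hL hε, fun Ω _ _ s => ?_, fun Ω _ _ _ xb => ?_⟩
  · obtain ⟨Θ, hamp, hcl⟩ := hΘ (s ≫ g)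
    exact exists_isAmple_cechClass_fibre_of_isBaseChangeVia_rev h hL (hasRank_pullback G hL) hc s (s ≫ g) rfl Θ hamp hcl
  · obtain ⟨Θ, hamp, hsym, hcl⟩ := hwit (xb ≫ g)
    exact exists_isAmple_symmetric_cechClass_fibre_of_isBaseChangeVia_rev h hL (hasRank_pullback G hL) hc xb (xb ≫ g) rfl Θ hamp hsym hcl

/-! ## §2 The α-witness is symmetric: `Θ + (−1)^*Θ` -/

/-- **The fibrewise witness of a polarization is symmetric ample**: for a polarization `λ` of `A∕S` with graph `Gr` (`Gr ≫ pr₁ = 𝟙`, `Gr ≫ pr₂ = λ`)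
and every geometric point `s`, there is an ample `Θ′` on `A_s` with `(−1)^*Θ′ ∼ Θ′` and `[Gr^*𝒫|_{A_s}] = [Θ′]` — namely `Θ′ = Θ + (−1)^*Θ` for the
`Θ` of ★ `Polarization.exists_ample` (`λ_s = φ_Θ`; class by ★ `detClass_restrict_LDelta_eq_cechClass_add_pullback_neg`, symmetry since `(−1)² = 1`).
[cite: MumfordFogartyKirwan1994, Ch. 6 §2 Definition 6.3–6.4 and Prop. 6.10 (pp. 120–121)] [cite: MumfordAV1970, §23 (p. 231) and §8 (iv) (p. 75)] -/
theorem Polarization.exists_isAmple_symmetric_pullback_fst_detClass_LDelta_eq_cechClass {S : Scheme.{0}} (A : AbelianSchemeOver S)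
    {D : A.DualPair} (pol : A.Polarization D)
    (Gr : A.X.left ⟶ A.prodLeft D.hat) (hGr₁ : Gr ≫ pullback.fst A.X.hom D.hat.X.hom = 𝟙 _) (hGr₂ : Gr ≫ pullback.snd A.X.hom D.hat.X.hom = pol.lam.left)
    (h : IsFiniteLocallyFree ((Scheme.Modules.pullback Gr).obj D.P))
    {Ω : Type} [Field Ω] [IsAlgClosed Ω] (s : Spec (.of Ω) ⟶ S) :
    ∃ Θ : CartierDivisor (A.fibre s).toAbelianVariety.X.left, Θ.IsAmple ∧
      (Θ.pullback (AbelianVariety.Hom.toSchemeHom (-𝟙 (A.fibre s).toAbelianVariety))).LinEquiv Θ ∧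
      CechPic.pullback (X := (A.fibre s).toAbelianVariety.X.left) (pullback.fst A.X.hom s) (detClass h) = Θ.cechClass := by
  obtain ⟨Θ, hΘ, hΛ⟩ := pol.exists_ample Ω s
  let B := (A.fibre s).toAbelianVariety
  let ν : B.X.left ⟶ B.X.left := AbelianVariety.Hom.toSchemeHom (-𝟙 B)
  have hνν : ν ≫ ν = 𝟙 B.X.left := by
    change AbelianVariety.Hom.toSchemeHom ((-𝟙 B) ≫ (-𝟙 B)) = 𝟙 B.X.left
    rw [Preadditive.neg_comp_neg, Category.comp_id]
    rfl
  haveI : IsIso ν := ⟨ν, hνν, hνν⟩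
  refine ⟨Θ + Θ.pullback ν, hΘ.add (hΘ.pullback ν), ?_, ?_⟩
  · refine CartierDivisor.SameDivisor.linEquiv ?_
    refine (CartierDivisor.pullback_add_sameDivisor Θ (Θ.pullback ν) ν).trans ?_
    refine CartierDivisor.SameDivisor.trans ?_ (CartierDivisor.add_comm_sameDivisor _ _)
    refine CartierDivisor.SameDivisor.add (CartierDivisor.SameDivisor.refl _) ?_
    refine (CartierDivisor.pullback_pullback_sameDivisor Θ ν ν).trans ?_
    exact (Θ.pullback_congr_sameDivisor hνν).trans Θ.pullback_id_sameDivisor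
  · exact (detClass_pullback (pullback.fst A.X.hom s) h).symm.trans
      (A.detClass_restrict_LDelta_eq_cechClass_add_pullback_neg D s rfl hΛ Gr hGr₁ hGr₂ _)

/-! ## §3 Steps 0–5: a rigidified rank-one bundle on a stage restriction of `𝒜ₜ`, of ample class at every geometric point, symmetric at the char-`0` ones -/

section Stage

variable {A : Type} [CommRing A] [IsDomain A] [Algebra.IsIntegral ℤ A]
  (K : Type) [Field K] [CharZero K] [Algebra A K] [IsFractionRing A K]
  {P : SchemeOver A} [QuasiCompact P.hom] [QuasiSeparated P.hom] [Flat P.hom]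
  [∀ s : Idx (nonZeroDivisors A), IsLocallyNoetherian (P ⊗ (baseDiagram (nonZeroDivisors A)).obj s).left]

/-- **Steps 0–5, iterated currency**: for some stages `ρ₁ : s₁ ⟶ t`, `ρ₂ : s₂ ⟶ s₁` there is a rank-one `L` on `(𝒜ₜ|_{s₁})|_{s₂}` with `ε^*[L] = 1`,
of ample class at EVERY geometric point of `P ⊗ D(s₂)` and of SYMMETRIC ample class at every characteristic-`0` one (chain α → β → η → γ → ζ of the
module docstring). [cite: MumfordFogartyKirwan1994, Ch. 6 §2 Prop. 6.10 (p. 121)] [cite: EGAIV3, Thm. 8.5.2 and Thm. 8.10.5]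
[cite: GortzWedhorn2023, Thm. 24.46 (p. 397)] [cite: MumfordAV1970, §6 Application 1 (p. 60)] -/
theorem exists_stage_stage_rankOne_rigidified_ample
    (A₁ : AbelianSchemeOver (P ⊗ specOver A K).left) (D₁ : A₁.DualPair) (pol₁ : A₁.Polarization D₁)
    (t : Idx (nonZeroDivisors A)) (𝒜ₜ : AbelianSchemeOver (P ⊗ (baseDiagram (nonZeroDivisors A)).obj t).left)
    (G : A₁.X.left ⟶ 𝒜ₜ.X.left) (hbc : A₁.IsBaseChangeVia 𝒜ₜ (P ◁ (baseCone (nonZeroDivisors A) K).π.app t).left G) :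
    ∃ (s₁ : Idx (nonZeroDivisors A)) (ρ₁ : s₁ ⟶ t) (s₂ : Idx (nonZeroDivisors A)) (ρ₂ : s₂ ⟶ s₁)
      (L : (((𝒜ₜ.baseChange (stageOver (nonZeroDivisors A) P ρ₁).hom).baseChange (stageOver (nonZeroDivisors A) P ρ₂).hom)).left.Modules)
      (hL : HasRank L 1),
      CechPic.pullback ((𝒜ₜ.baseChange (stageOver (nonZeroDivisors A) P ρ₁).hom).baseChange (stageOver (nonZeroDivisors A) P ρ₂).hom).unitSection
          (detClass (HasRank.isFiniteLocallyFree' hL)) = 1 ∧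
      (∀ ⦃Ω : Type⦄ [Field Ω] [IsAlgClosed Ω] (z : Spec (.of Ω) ⟶ (P ⊗ (baseDiagram (nonZeroDivisors A)).obj s₂).left),
        ∃ Θ : CartierDivisor ((((𝒜ₜ.baseChange (stageOver (nonZeroDivisors A) P ρ₁).hom).baseChange
            (stageOver (nonZeroDivisors A) P ρ₂).hom)).fibre z).toAbelianVariety.X.left, Θ.IsAmple ∧
          CechPic.pullback (X := ((((𝒜ₜ.baseChange (stageOver (nonZeroDivisors A) P ρ₁).hom).baseChange
              (stageOver (nonZeroDivisors A) P ρ₂).hom)).fibre z).toAbelianVariety.X.left)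
            (pullback.fst ((𝒜ₜ.baseChange (stageOver (nonZeroDivisors A) P ρ₁).hom).baseChange (stageOver (nonZeroDivisors A) P ρ₂).hom).X.hom z)
            (detClass (HasRank.isFiniteLocallyFree' hL)) = Θ.cechClass) ∧
      (∀ ⦃Ω : Type⦄ [Field Ω] [IsAlgClosed Ω] [CharZero Ω] (z : Spec (.of Ω) ⟶ (P ⊗ (baseDiagram (nonZeroDivisors A)).obj s₂).left),
        ∃ Θ : CartierDivisor ((((𝒜ₜ.baseChange (stageOver (nonZeroDivisors A) P ρ₁).hom).baseChange
            (stageOver (nonZeroDivisors A) P ρ₂).hom)).fibre z).toAbelianVariety.X.left, Θ.IsAmple ∧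
          (Θ.pullback (AbelianVariety.Hom.toSchemeHom (-𝟙 ((((𝒜ₜ.baseChange (stageOver (nonZeroDivisors A) P ρ₁).hom).baseChange
              (stageOver (nonZeroDivisors A) P ρ₂).hom)).fibre z).toAbelianVariety))).LinEquiv Θ ∧
          CechPic.pullback (X := ((((𝒜ₜ.baseChange (stageOver (nonZeroDivisors A) P ρ₁).hom).baseChange
              (stageOver (nonZeroDivisors A) P ρ₂).hom)).fibre z).toAbelianVariety.X.left)
            (pullback.fst ((𝒜ₜ.baseChange (stageOver (nonZeroDivisors A) P ρ₁).hom).baseChange (stageOver (nonZeroDivisors A) P ρ₂).hom).X.hom z)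
            (detClass (HasRank.isFiniteLocallyFree' hL)) = Θ.cechClass) := by
  classical
  -- (0) α: the Mumford bundle `L₁ = Gr^*𝒫` of `pol₁` on `A₁`
  let Gr : A₁.X.left ⟶ A₁.prodLeft D₁.hat := pullback.lift (𝟙 _) pol₁.lam.left (by rw [Category.id_comp]; exact (Over.w pol₁.lam).symm)
  have hGr₁ : Gr ≫ pullback.fst A₁.X.hom D₁.hat.X.hom = 𝟙 _ := pullback.lift_fst _ _ _
  have hGr₂ : Gr ≫ pullback.snd A₁.X.hom D₁.hat.X.hom = pol₁.lam.left := pullback.lift_snd _ _ _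
  let L₁ : A₁.left.Modules := (Scheme.Modules.pullback Gr).obj D₁.P
  have hL₁ : HasRank L₁ 1 := A₁.hasRank_pullback_graph_P Gr
  -- (1) the literal generic base change `ℬ = 𝒜ₜ ×_{P⊗D(t)} (P ⊗ Spec K)` and the comparison `H : A₁ ≅ ℬ`
  let ℬ : AbelianSchemeOver (P ⊗ specOver A K).left := 𝒜ₜ.baseChange (genOver (nonZeroDivisors A) K P t).hom
  obtain ⟨H, hHG, hHπ⟩ := IsBaseChangeVia.exists_iso_comp_eq (𝒜ₜ.baseChange_isBaseChangeVia (genOver (nonZeroDivisors A) K P t).hom) hbc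
  have hid : A₁.IsBaseChangeVia ℬ (𝟙 _) H.hom :=
    isBaseChangeVia_id_of_comp_eq (𝒜ₜ.baseChange_isBaseChangeVia (genOver (nonZeroDivisors A) K P t).hom) hbc H.hom hHG hHπ
  let M : ℬ.left.Modules := (Scheme.Modules.pullback H.inv).obj L₁
  have hM : HasRank M 1 := hasRank_pullback _ hL₁
  have hML₁ : detClass (HasRank.isFiniteLocallyFree' hL₁) = CechPic.pullback H.hom (detClass (HasRank.isFiniteLocallyFree' hM)) := by
    rw [(detClass_eq_of_iso (Iso.refl _) (HasRank.isFiniteLocallyFree' hM) ((HasRank.isFiniteLocallyFree' hL₁).pullback H.inv)),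
      detClass_pullback H.inv (HasRank.isFiniteLocallyFree' hL₁), ← CechPic.pullback_comp, H.hom_inv_id, Modules.CechPic.pullback_id'']
  -- (2) β: spread `M` to a rank-one `M₁` on the stage restriction `𝒜′ = 𝒜ₜ|_{s₁}`
  haveI : Flat (pullback.snd P.hom ((baseDiagram (nonZeroDivisors A)).obj t).hom) := MorphismProperty.pullback_snd (P := @Flat) _ _ inferInstance
  haveI : Smooth 𝒜ₜ.X.hom := 𝒜ₜ.isSmooth
  haveI : IsProper 𝒜ₜ.X.hom := 𝒜ₜ.isProper
  haveI : Flat 𝒜ₜ.X.hom := inferInstance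
  haveI : QuasiCompact 𝒜ₜ.X.hom := inferInstance
  haveI : QuasiSeparated 𝒜ₜ.X.hom := inferInstance
  obtain ⟨s₁, ρ₁, M₁, hM₁, ⟨eβ⟩⟩ := exists_stage_hasRank_of_generic K 𝒜ₜ.X (M := M) hM
  let 𝒜' : AbelianSchemeOver (P ⊗ (baseDiagram (nonZeroDivisors A)).obj s₁).left := 𝒜ₜ.baseChange (stageOver (nonZeroDivisors A) P ρ₁).hom
  -- (3) η: rigidify
  obtain ⟨L', hL', hε', hfib'⟩ := 𝒜'.exists_rankOne_rigidified_sameFibreClass M₁ hM₁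
  -- (4) the comparison `ℬ → 𝒜′` along the relative leg and the generic reading `hgen` of `L′`
  obtain ⟨m', hm'bc, hm'fst⟩ := exists_isBaseChangeVia_baseChange_of_over_hom (relLeg (nonZeroDivisors A) K P ρ₁) 𝒜ₜ
    (𝒜ₜ.baseChange_isBaseChangeVia (genOver (nonZeroDivisors A) K P t).hom)
  have hm'eq : m' = (𝒜ₜ.X ◁ relLeg (nonZeroDivisors A) K P ρ₁).left := by
    obtain ⟨wm, -, -, -⟩ := hm'bc
    apply pullback.hom_ext
    · rw [hm'fst]
      exact (Over.whiskerLeft_left_fst _).symm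
    · have h2 : (𝒜ₜ.X ◁ relLeg (nonZeroDivisors A) K P ρ₁).left ≫ pullback.snd 𝒜ₜ.X.hom (stageOver (nonZeroDivisors A) P ρ₁).hom =
          pullback.snd 𝒜ₜ.X.hom (genOver (nonZeroDivisors A) K P t).hom ≫ (relLeg (nonZeroDivisors A) K P ρ₁).left :=
        Over.whiskerLeft_left_snd _
      rw [h2]
      exact wm
  have hMM₁ : detClass (HasRank.isFiniteLocallyFree' hM) = CechPic.pullback m' (detClass (HasRank.isFiniteLocallyFree' hM₁)) := by
    rw [hm'eq, detClass_eq_of_iso eβ.symm (HasRank.isFiniteLocallyFree' hM) ((HasRank.isFiniteLocallyFree' hM₁).pullback _),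
      detClass_pullback _ (HasRank.isFiniteLocallyFree' hM₁)]
    rfl
  have hgen : ∀ (Ω : Type) [Field Ω] [IsAlgClosed Ω] (yb : Spec (.of Ω) ⟶ (P ⊗ specOver A K).left),
      ∃ Θ : CartierDivisor (𝒜'.fibre (yb ≫ (P ◁ leg (nonZeroDivisors A) K s₁).left)).toAbelianVariety.X.left, Θ.IsAmple ∧
        (Θ.pullback (AbelianVariety.Hom.toSchemeHom (-𝟙 (𝒜'.fibre (yb ≫ (P ◁ leg (nonZeroDivisors A) K s₁).left)).toAbelianVariety))).LinEquiv Θ ∧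
        CechPic.pullback (X := (𝒜'.fibre (yb ≫ (P ◁ leg (nonZeroDivisors A) K s₁).left)).toAbelianVariety.X.left)
          (pullback.fst 𝒜'.X.hom (yb ≫ (P ◁ leg (nonZeroDivisors A) K s₁).left)) (detClass (HasRank.isFiniteLocallyFree' hL')) = Θ.cechClass := by
    intro Ω _ _ yb
    -- α at `yb` (symmetric), moved along `H` to `ℬ`, then along `m′` to `𝒜′`, then to `L′` by η's fibre clause
    obtain ⟨Θ₀, hΘ₀, hsym₀, hc₀⟩ := pol₁.exists_isAmple_symmetric_pullback_fst_detClass_LDelta_eq_cechClass A₁ Gr hGr₁ hGr₂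
      (HasRank.isFiniteLocallyFree' hL₁) yb
    obtain ⟨Θ₁, hΘ₁, hsym₁, hc₁⟩ := exists_isAmple_symmetric_cechClass_fibre_of_isBaseChangeVia hid hM hL₁ hML₁ yb yb (Category.comp_id _)
      Θ₀ hΘ₀ hsym₀ hc₀
    obtain ⟨Θ₂, hΘ₂, hsym₂, hc₂⟩ := exists_isAmple_symmetric_cechClass_fibre_of_isBaseChangeVia hm'bc hM₁ hM hMM₁ yb
      (yb ≫ (P ◁ leg (nonZeroDivisors A) K s₁).left) rfl Θ₁ hΘ₁ hsym₁ hc₁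
    exact ⟨Θ₂, hΘ₂, hsym₂, (hfib' _).trans hc₂⟩
  -- (5) γ: ample class at EVERY geometric point of a finer stage `s₂`; ζ: symmetric at the char-`0` ones
  obtain ⟨s₂, ρ₂, hΘ⟩ := exists_stage_forall_isAmple_detClass_eq_cechClass K 𝒜' L' hL' hgen
  refine ⟨s₁, ρ₁, s₂, ρ₂, (Scheme.Modules.pullback (pullback.fst 𝒜'.X.hom (stageOver (nonZeroDivisors A) P ρ₂).hom)).obj L',
    hasRank_pullback (pullback.fst 𝒜'.X.hom (stageOver (nonZeroDivisors A) P ρ₂).hom) hL',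
    𝒜'.pullback_unitSection_detClass_baseChange_eq_one (stageOver (nonZeroDivisors A) P ρ₂).hom hL' hε', fun Ω _ _ z => hΘ Ω z, ?_⟩
  intro Ω _ _ _ z
  obtain ⟨yb, hyb⟩ := exists_eq_comp_whiskerLeft_leg_of_charZero_of_isIntegral_int K P z
  have key : ∀ (w : Spec (.of Ω) ⟶ (P ⊗ (baseDiagram (nonZeroDivisors A)).obj s₂).left)
      (hw : w = yb ≫ (P ◁ leg (nonZeroDivisors A) K s₂).left),
      ∃ Θ : CartierDivisor ((𝒜'.baseChange (stageOver (nonZeroDivisors A) P ρ₂).hom).fibre w).toAbelianVariety.X.left, Θ.IsAmple ∧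
        (Θ.pullback (AbelianVariety.Hom.toSchemeHom (-𝟙 ((𝒜'.baseChange (stageOver (nonZeroDivisors A) P ρ₂).hom).fibre w).toAbelianVariety))).LinEquiv Θ ∧
        CechPic.pullback (X := ((𝒜'.baseChange (stageOver (nonZeroDivisors A) P ρ₂).hom).fibre w).toAbelianVariety.X.left)
          (pullback.fst (𝒜'.baseChange (stageOver (nonZeroDivisors A) P ρ₂).hom).X.hom w)
          (detClass (HasRank.isFiniteLocallyFree'
            (hasRank_pullback (pullback.fst 𝒜'.X.hom (stageOver (nonZeroDivisors A) P ρ₂).hom) hL'))) = Θ.cechClass := by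
    rintro w rfl
    exact exists_isAmple_symmetric_detClass_eq_cechClass_stage_of_generic K 𝒜' L' hL' ρ₂ hgen Ω yb
  exact key z hyb.symm

/-- **HEAD — a rigidified rank-one bundle of ample class everywhere, symmetric in characteristic `0`, on ONE stage restriction `𝒜ₜ|_{s₂}`**
(`ρ : s₂ ⟶ t`): the binders `hε`∕`hΘ` of ★ `exists_nat_forall_chart_pow_eq_one_of_memKOfL` and `hwit` of ★
`exists_opens_finite_image_compl_forall_affineOpen_isProjective_of_cechClass` VERBATIM for `𝒜ₜ.baseChange (stageOver _ P ρ).hom` — the iterated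
statement re-based along `𝟙` by §1b (★ `IsBaseChangeVia.trans` ∕ `exists_iso_comp_eq` ∕ `isBaseChangeVia_id_of_comp_eq`).
[cite: MumfordFogartyKirwan1994, Ch. 6 §2 Prop. 6.10 (p. 121)] [cite: EGAIV3, Thm. 8.5.2 and Thm. 8.10.5] [cite: GortzWedhorn2023, Thm. 24.46 (p. 397)] -/
theorem exists_stage_rankOne_rigidified_ample
    (A₁ : AbelianSchemeOver (P ⊗ specOver A K).left) (D₁ : A₁.DualPair) (pol₁ : A₁.Polarization D₁)
    (t : Idx (nonZeroDivisors A)) (𝒜ₜ : AbelianSchemeOver (P ⊗ (baseDiagram (nonZeroDivisors A)).obj t).left)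
    (G : A₁.X.left ⟶ 𝒜ₜ.X.left) (hbc : A₁.IsBaseChangeVia 𝒜ₜ (P ◁ (baseCone (nonZeroDivisors A) K).π.app t).left G) :
    ∃ (s₂ : Idx (nonZeroDivisors A)) (ρ : s₂ ⟶ t) (L : (𝒜ₜ.baseChange (stageOver (nonZeroDivisors A) P ρ).hom).left.Modules) (hL : HasRank L 1),
      CechPic.pullback (𝒜ₜ.baseChange (stageOver (nonZeroDivisors A) P ρ).hom).unitSection (detClass (HasRank.isFiniteLocallyFree' hL)) = 1 ∧
      (∀ ⦃Ω : Type⦄ [Field Ω] [IsAlgClosed Ω] (z : Spec (.of Ω) ⟶ (P ⊗ (baseDiagram (nonZeroDivisors A)).obj s₂).left),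
        ∃ Θ : CartierDivisor ((𝒜ₜ.baseChange (stageOver (nonZeroDivisors A) P ρ).hom).fibre z).toAbelianVariety.X.left, Θ.IsAmple ∧
          CechPic.pullback (X := ((𝒜ₜ.baseChange (stageOver (nonZeroDivisors A) P ρ).hom).fibre z).toAbelianVariety.X.left)
            (pullback.fst (𝒜ₜ.baseChange (stageOver (nonZeroDivisors A) P ρ).hom).X.hom z)
            (detClass (HasRank.isFiniteLocallyFree' hL)) = Θ.cechClass) ∧
      (∀ ⦃Ω : Type⦄ [Field Ω] [IsAlgClosed Ω] [CharZero Ω] (z : Spec (.of Ω) ⟶ (P ⊗ (baseDiagram (nonZeroDivisors A)).obj s₂).left),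
        ∃ Θ : CartierDivisor ((𝒜ₜ.baseChange (stageOver (nonZeroDivisors A) P ρ).hom).fibre z).toAbelianVariety.X.left, Θ.IsAmple ∧
          (Θ.pullback (AbelianVariety.Hom.toSchemeHom (-𝟙 ((𝒜ₜ.baseChange (stageOver (nonZeroDivisors A) P ρ).hom).fibre z).toAbelianVariety))).LinEquiv Θ ∧
          CechPic.pullback (X := ((𝒜ₜ.baseChange (stageOver (nonZeroDivisors A) P ρ).hom).fibre z).toAbelianVariety.X.left)
            (pullback.fst (𝒜ₜ.baseChange (stageOver (nonZeroDivisors A) P ρ).hom).X.hom z)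
            (detClass (HasRank.isFiniteLocallyFree' hL)) = Θ.cechClass) := by
  obtain ⟨s₁, ρ₁, s₂, ρ₂, L, hL, hε, hΘ, hwit⟩ := exists_stage_stage_rankOne_rigidified_ample K A₁ D₁ pol₁ t 𝒜ₜ G hbc
  -- the iterated base change `(𝒜ₜ|_{s₁})|_{s₂}` and the single one `𝒜ₜ|_{s₂}` along `ρ₂ ≫ ρ₁` are related along `𝟙`
  have h₂ : ((𝒜ₜ.baseChange (stageOver (nonZeroDivisors A) P ρ₁).hom).baseChange (stageOver (nonZeroDivisors A) P ρ₂).hom).IsBaseChangeVia 𝒜ₜ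
      ((stageOver (nonZeroDivisors A) P ρ₂).hom ≫ (stageOver (nonZeroDivisors A) P ρ₁).hom)
      (pullback.fst (𝒜ₜ.baseChange (stageOver (nonZeroDivisors A) P ρ₁).hom).X.hom (stageOver (nonZeroDivisors A) P ρ₂).hom ≫
        pullback.fst 𝒜ₜ.X.hom (stageOver (nonZeroDivisors A) P ρ₁).hom) :=
    ((𝒜ₜ.baseChange (stageOver (nonZeroDivisors A) P ρ₁).hom).baseChange_isBaseChangeVia (stageOver (nonZeroDivisors A) P ρ₂).hom).trans
      (𝒜ₜ.baseChange_isBaseChangeVia (stageOver (nonZeroDivisors A) P ρ₁).hom)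
  have heq : (stageOver (nonZeroDivisors A) P ρ₂).hom ≫ (stageOver (nonZeroDivisors A) P ρ₁).hom = (stageOver (nonZeroDivisors A) P (ρ₂ ≫ ρ₁)).hom :=
    whiskerLeft_map_left_comp_whiskerLeft_map_left (nonZeroDivisors A) P ρ₂ ρ₁
  rw [heq] at h₂
  have h₁ := 𝒜ₜ.baseChange_isBaseChangeVia (stageOver (nonZeroDivisors A) P (ρ₂ ≫ ρ₁)).hom
  obtain ⟨H, hHG, hHπ⟩ := IsBaseChangeVia.exists_iso_comp_eq h₂ h₁
  have hid := isBaseChangeVia_id_of_comp_eq h₂ h₁ H.hom hHG hHπ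
  obtain ⟨hε', hΘ', hwit'⟩ := hid.rankOne_rigidified_ample_pullback hL hε hΘ hwit
  exact ⟨s₂, ρ₂ ≫ ρ₁, (Scheme.Modules.pullback H.hom).obj L, hasRank_pullback H.hom hL, hε', hΘ', hwit'⟩

end Stage

end AbelianSchemeOver

end Literature.AlgebraicGeometry.AbelianSchemes

end
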